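import Mathlib.Analysis.SpecialFunctions.Pow.Continuity
import Mathlib.Analysis.Normed.Group.Constructions
import HarnessLib

/-!
# `‖x‖_∞ = lim_{p → ∞} ‖x‖_p` and `lim_{p → −∞} ‖x‖_p = min |x_i|` (Horn–Johnson 5.4.P7)

Hodge foundations lane (`lit-hodgefound`, prover p24 gen 40; matrix-analysis series).  THEOREMS ONLY; no definition,
no named fact, net debt 0.  Setting: a finite family `x : ι → E` of vectors of any seminormed group `E` (for
`E = 𝕜 = ℝ, ℂ` this is `x ∈ 𝕜ⁿ`), its `l_p` "norm" written out as `(∑ i, ‖x i‖ ^ p) ^ p⁻¹` for a REAL exponent `p`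
(the book's `(∑ |x_i|^p)^{1/p}`, cf. the tree's `Literature.Analysis.Matrix.VectorLpNormBounds`), and `‖x‖` the sup
norm of `ι → E` (`= max_i ‖x i‖ = ‖x‖_∞`).

Source (held, read at the page): [HJ13] = R. A. Horn, C. R. Johnson, *Matrix Analysis*, 2nd ed. (CUP 2013)
[HornJohnson2013] (held text `book:horn2012-matrix-analysis`, § 5.4 Problems p0423), VERBATIM:

* **5.4.P7** "Show that `‖x‖_∞ = lim_{p→∞} ‖x‖_p` for every `x ∈ ℂⁿ`. If `|x| > 0`, what is `lim_{p→−∞} ‖x‖_p`?"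

(Here `|x| > 0` is the book's entrywise notation: every `x_i ≠ 0`; the answer is `min_i |x_i|`.)

## What is formalized (all PROVED)

* § 1 (the two-sided bound behind the limit, `p > 0`): `exists_norm_eq_norm_apply` (the sup norm is attained),
  `norm_rpow_le_sum_rpow` (`‖x‖^p ≤ ∑ ‖x_i‖^p`), `sum_rpow_le_card_mul_norm_rpow` (`∑ ‖x_i‖^p ≤ n ‖x‖^p`),
  **`norm_le_lpNorm`** (`‖x‖_∞ ≤ ‖x‖_p`), **`lpNorm_le_card_rpow_mul_norm`** (`‖x‖_p ≤ n^{1/p} ‖x‖_∞`).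
* § 2 **5.4.P7, first part**: `tendsto_card_rpow_inv_atTop` (`n^{1/p} → 1`), **`tendsto_lpNorm_atTop`**
  (`(∑ ‖x_i‖^p)^{1/p} → ‖x‖_∞` as `p → ∞`; squeeze), and the `1/p`-spelling `tendsto_lpNorm_atTop'`.
* § 3 **5.4.P7, second part** (`p < 0`, all `x_i ≠ 0`, `m = min_i ‖x_i‖`): `inf_rpow_le_sum_rpow`,
  `sum_rpow_le_card_mul_inf_rpow` (`m^p ≤ ∑ ‖x_i‖^p ≤ n m^p`), **`lpNorm_le_inf`**, **`card_rpow_mul_inf_le_lpNorm`**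
  (`n^{1/p} m ≤ ‖x‖_p ≤ m` for `p < 0`), `tendsto_card_rpow_inv_atBot`, **`tendsto_lpNorm_atBot`**
  (`‖x‖_p → min_i ‖x_i‖` as `p → −∞`).
-/

open Filter Finset
open scoped Topology

namespace Literature.Analysis.Matrix.LpNormLimit

variable {ι : Type*} [Fintype ι] {E : Type*} [SeminormedAddCommGroup E]

/-! ## § 1. `‖x‖_∞ ≤ ‖x‖_p ≤ n^{1/p} ‖x‖_∞` for `p > 0` -/

omit [Fintype ι] in
/-- The sup norm of a finite family is attained: `‖x‖ = ‖x i‖` for some `i` (nonempty index set).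
[cite: HornJohnson2013, 5.4.P7 (p0423)] -/
theorem exists_norm_eq_norm_apply [Fintype ι] [Nonempty ι] (x : ι → E) : ∃ i, ‖x‖ = ‖x i‖ := by
  obtain ⟨i, -, hi⟩ := Finset.exists_mem_eq_sup Finset.univ Finset.univ_nonempty fun b => ‖x b‖₊
  exact ⟨i, by rw [Pi.norm_def, hi, coe_nnnorm]⟩

/-- `‖x‖_∞^p ≤ ∑ ‖x_i‖^p` for `p > 0`. [cite: HornJohnson2013, 5.4.P7 (p0423)] -/
theorem norm_rpow_le_sum_rpow (x : ι → E) {p : ℝ} (hp : 0 < p) : ‖x‖ ^ p ≤ ∑ i, ‖x i‖ ^ p := by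
  cases isEmpty_or_nonempty ι
  · have hx : x = 0 := Subsingleton.elim _ _
    rw [hx, norm_zero, Real.zero_rpow hp.ne']
    exact Finset.sum_nonneg fun i _ => Real.rpow_nonneg (norm_nonneg _) _
  · obtain ⟨i, hi⟩ := exists_norm_eq_norm_apply x
    rw [hi]
    exact Finset.single_le_sum (f := fun j => ‖x j‖ ^ p) (fun j _ => Real.rpow_nonneg (norm_nonneg _) _)
      (Finset.mem_univ i)

/-- `∑ ‖x_i‖^p ≤ n ‖x‖_∞^p` for `p ≥ 0`. [cite: HornJohnson2013, 5.4.P7 (p0423)] -/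
theorem sum_rpow_le_card_mul_norm_rpow (x : ι → E) {p : ℝ} (hp : 0 ≤ p) :
    ∑ i, ‖x i‖ ^ p ≤ Fintype.card ι * ‖x‖ ^ p := by
  calc ∑ i, ‖x i‖ ^ p ≤ ∑ _i : ι, ‖x‖ ^ p :=
        Finset.sum_le_sum fun i _ => Real.rpow_le_rpow (norm_nonneg _) (norm_le_pi_norm x i) hp
    _ = Fintype.card ι * ‖x‖ ^ p := by rw [Finset.sum_const, nsmul_eq_mul, Finset.card_univ]

/-- **`‖x‖_∞ ≤ ‖x‖_p`** (`p > 0`). [cite: HornJohnson2013, 5.4.P7 (p0423)] -/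
theorem norm_le_lpNorm (x : ι → E) {p : ℝ} (hp : 0 < p) : ‖x‖ ≤ (∑ i, ‖x i‖ ^ p) ^ p⁻¹ := by
  calc ‖x‖ = (‖x‖ ^ p) ^ p⁻¹ := (Real.rpow_rpow_inv (norm_nonneg _) hp.ne').symm
    _ ≤ (∑ i, ‖x i‖ ^ p) ^ p⁻¹ :=
        Real.rpow_le_rpow (Real.rpow_nonneg (norm_nonneg _) _) (norm_rpow_le_sum_rpow x hp)
          (inv_nonneg.mpr hp.le)

/-- **`‖x‖_p ≤ n^{1/p} ‖x‖_∞`** (`p > 0`). [cite: HornJohnson2013, 5.4.P7 (p0423)] -/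
theorem lpNorm_le_card_rpow_mul_norm (x : ι → E) {p : ℝ} (hp : 0 < p) :
    (∑ i, ‖x i‖ ^ p) ^ p⁻¹ ≤ (Fintype.card ι : ℝ) ^ p⁻¹ * ‖x‖ := by
  calc (∑ i, ‖x i‖ ^ p) ^ p⁻¹ ≤ (Fintype.card ι * ‖x‖ ^ p) ^ p⁻¹ :=
        Real.rpow_le_rpow (Finset.sum_nonneg fun i _ => Real.rpow_nonneg (norm_nonneg _) _)
          (sum_rpow_le_card_mul_norm_rpow x hp.le) (inv_nonneg.mpr hp.le)
    _ = (Fintype.card ι : ℝ) ^ p⁻¹ * ‖x‖ := by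
        rw [Real.mul_rpow (Nat.cast_nonneg _) (Real.rpow_nonneg (norm_nonneg _) _),
          Real.rpow_rpow_inv (norm_nonneg _) hp.ne']

/-! ## § 2. 5.4.P7: `‖x‖_p → ‖x‖_∞` as `p → ∞` -/

/-- `n^{1/p} → 1` as `p → ∞` (`n ≥ 1`; for `n = 0` the index set is empty and everything vanishes).
[cite: HornJohnson2013, 5.4.P7 (p0423)] -/
theorem tendsto_card_rpow_inv_atTop {c : ℝ} (hc : c ≠ 0) : Tendsto (fun p : ℝ => c ^ p⁻¹) atTop (𝓝 1) := by
  have h := ((Real.continuousAt_const_rpow hc).tendsto).comp tendsto_inv_atTop_zero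
  rwa [Real.rpow_zero] at h

/-- **5.4.P7**: `‖x‖_∞ = lim_{p → ∞} ‖x‖_p`, i.e. `(∑ ‖x_i‖^p)^{1/p} → ‖x‖_∞ = max_i ‖x_i‖` as `p → ∞` (squeeze
between `‖x‖_∞` and `n^{1/p}‖x‖_∞`). [cite: HornJohnson2013, 5.4.P7 (p0423)] -/
theorem tendsto_lpNorm_atTop (x : ι → E) :
    Tendsto (fun p : ℝ => (∑ i, ‖x i‖ ^ p) ^ p⁻¹) atTop (𝓝 ‖x‖) := by
  cases isEmpty_or_nonempty ι
  · have hx : x = 0 := Subsingleton.elim _ _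
    have h0 : (fun p : ℝ => (∑ i, ‖x i‖ ^ p) ^ p⁻¹) =ᶠ[atTop] fun _ => 0 := by
      filter_upwards [eventually_gt_atTop 0] with p hp
      rw [Finset.univ_eq_empty, Finset.sum_empty, Real.zero_rpow (inv_ne_zero hp.ne')]
    have hn : ‖x‖ = 0 := by rw [hx, norm_zero]
    rw [hn]
    exact Tendsto.congr' h0.symm tendsto_const_nhds
  · have hc : (Fintype.card ι : ℝ) ≠ 0 := Nat.cast_ne_zero.mpr Fintype.card_ne_zero
    have hup : Tendsto (fun p : ℝ => (Fintype.card ι : ℝ) ^ p⁻¹ * ‖x‖) atTop (𝓝 ‖x‖) := by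
      have h := (tendsto_card_rpow_inv_atTop hc).mul_const ‖x‖
      rwa [one_mul] at h
    refine tendsto_of_tendsto_of_tendsto_of_le_of_le' tendsto_const_nhds hup ?_ ?_
    · filter_upwards [eventually_gt_atTop 0] with p hp using norm_le_lpNorm x hp
    · filter_upwards [eventually_gt_atTop 0] with p hp using lpNorm_le_card_rpow_mul_norm x hp

/-- 5.4.P7 with the exponent written `1/p`. [cite: HornJohnson2013, 5.4.P7 (p0423)] -/
theorem tendsto_lpNorm_atTop' (x : ι → E) :
    Tendsto (fun p : ℝ => (∑ i, ‖x i‖ ^ p) ^ (1 / p)) atTop (𝓝 ‖x‖) := by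
  simp only [one_div]
  exact tendsto_lpNorm_atTop x

/-- 5.4.P7 for scalar vectors `x ∈ 𝕜ⁿ` (`𝕜` any normed field, e.g. `ℝ` or `ℂ`): `(∑ |x_i|^p)^{1/p} → max_i |x_i|`.
[cite: HornJohnson2013, 5.4.P7 (p0423)] -/
theorem tendsto_lpNorm_atTop_pi {𝕜 : Type*} [NormedField 𝕜] (x : ι → 𝕜) :
    Tendsto (fun p : ℝ => (∑ i, ‖x i‖ ^ p) ^ (1 / p)) atTop (𝓝 ‖x‖) :=
  tendsto_lpNorm_atTop' x

/-! ## § 3. 5.4.P7, second part: `‖x‖_p → min_i |x_i|` as `p → −∞` when every `x_i ≠ 0` -/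

section Neg

variable [Nonempty ι]

/-- For `p ≤ 0` and all `‖x_i‖ > 0`: `m^p ≤ ∑ ‖x_i‖^p` with `m = min_i ‖x_i‖` (attained at a minimising index).
[cite: HornJohnson2013, 5.4.P7 (p0423)] -/
theorem inf_rpow_le_sum_rpow (x : ι → E) (p : ℝ) :
    (Finset.univ.inf' Finset.univ_nonempty fun i => ‖x i‖) ^ p ≤ ∑ i, ‖x i‖ ^ p := by
  obtain ⟨i, -, hi⟩ := Finset.exists_mem_eq_inf' Finset.univ_nonempty fun j => ‖x j‖
  rw [hi]
  exact Finset.single_le_sum (f := fun j => ‖x j‖ ^ p) (fun j _ => Real.rpow_nonneg (norm_nonneg _) _)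
    (Finset.mem_univ i)

/-- For `p ≤ 0` and all `x_i ≠ 0`: `∑ ‖x_i‖^p ≤ n m^p`, `m = min_i ‖x_i‖ > 0` (`t ↦ t^p` is antitone on `(0, ∞)`).
[cite: HornJohnson2013, 5.4.P7 (p0423)] -/
theorem sum_rpow_le_card_mul_inf_rpow (x : ι → E) (hx : ∀ i, ‖x i‖ ≠ 0) {p : ℝ} (hp : p ≤ 0) :
    ∑ i, ‖x i‖ ^ p ≤ Fintype.card ι * (Finset.univ.inf' Finset.univ_nonempty fun i => ‖x i‖) ^ p := by
  have hm : 0 < Finset.univ.inf' Finset.univ_nonempty fun i => ‖x i‖ := by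
    rw [Finset.lt_inf'_iff]
    exact fun i _ => lt_of_le_of_ne (norm_nonneg _) (hx i).symm
  calc ∑ i, ‖x i‖ ^ p ≤ ∑ _i : ι, (Finset.univ.inf' Finset.univ_nonempty fun i => ‖x i‖) ^ p :=
        Finset.sum_le_sum fun i _ =>
          Real.rpow_le_rpow_of_nonpos hm (Finset.inf'_le (fun j => ‖x j‖) (Finset.mem_univ i)) hp
    _ = Fintype.card ι * (Finset.univ.inf' Finset.univ_nonempty fun i => ‖x i‖) ^ p := by
        rw [Finset.sum_const, nsmul_eq_mul, Finset.card_univ]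

/-- **`‖x‖_p ≤ min_i ‖x_i‖`** for `p < 0` (all `x_i ≠ 0`). [cite: HornJohnson2013, 5.4.P7 (p0423)] -/
theorem lpNorm_le_inf (x : ι → E) (hx : ∀ i, ‖x i‖ ≠ 0) {p : ℝ} (hp : p < 0) :
    (∑ i, ‖x i‖ ^ p) ^ p⁻¹ ≤ Finset.univ.inf' Finset.univ_nonempty fun i => ‖x i‖ := by
  have hm : 0 < Finset.univ.inf' Finset.univ_nonempty fun i => ‖x i‖ := by
    rw [Finset.lt_inf'_iff]
    exact fun i _ => lt_of_le_of_ne (norm_nonneg _) (hx i).symm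
  calc (∑ i, ‖x i‖ ^ p) ^ p⁻¹ ≤ ((Finset.univ.inf' Finset.univ_nonempty fun i => ‖x i‖) ^ p) ^ p⁻¹ :=
        Real.rpow_le_rpow_of_nonpos (Real.rpow_pos_of_pos hm _) (inf_rpow_le_sum_rpow x p) (inv_nonpos.mpr hp.le)
    _ = Finset.univ.inf' Finset.univ_nonempty fun i => ‖x i‖ := Real.rpow_rpow_inv hm.le hp.ne

/-- **`n^{1/p} min_i ‖x_i‖ ≤ ‖x‖_p`** for `p < 0` (all `x_i ≠ 0`). [cite: HornJohnson2013, 5.4.P7 (p0423)] -/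
theorem card_rpow_mul_inf_le_lpNorm (x : ι → E) (hx : ∀ i, ‖x i‖ ≠ 0) {p : ℝ} (hp : p < 0) :
    (Fintype.card ι : ℝ) ^ p⁻¹ * (Finset.univ.inf' Finset.univ_nonempty fun i => ‖x i‖) ≤
      (∑ i, ‖x i‖ ^ p) ^ p⁻¹ := by
  have hm : 0 < Finset.univ.inf' Finset.univ_nonempty fun i => ‖x i‖ := by
    rw [Finset.lt_inf'_iff]
    exact fun i _ => lt_of_le_of_ne (norm_nonneg _) (hx i).symm
  have hpos : 0 < ∑ i, ‖x i‖ ^ p := lt_of_lt_of_le (Real.rpow_pos_of_pos hm _) (inf_rpow_le_sum_rpow x p)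
  calc (Fintype.card ι : ℝ) ^ p⁻¹ * (Finset.univ.inf' Finset.univ_nonempty fun i => ‖x i‖)
        = (Fintype.card ι * (Finset.univ.inf' Finset.univ_nonempty fun i => ‖x i‖) ^ p) ^ p⁻¹ := by
          rw [Real.mul_rpow (Nat.cast_nonneg _) (Real.rpow_nonneg hm.le _), Real.rpow_rpow_inv hm.le hp.ne]
    _ ≤ (∑ i, ‖x i‖ ^ p) ^ p⁻¹ :=
          Real.rpow_le_rpow_of_nonpos hpos (sum_rpow_le_card_mul_inf_rpow x hx hp.le) (inv_nonpos.mpr hp.le)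

omit [Nonempty ι] in
/-- `c^{1/p} → 1` as `p → −∞` (`c ≠ 0`).
[cite: HornJohnson2013, 5.4.P7 (p0423)] -/
theorem tendsto_card_rpow_inv_atBot {c : ℝ} (hc : c ≠ 0) : Tendsto (fun p : ℝ => c ^ p⁻¹) atBot (𝓝 1) := by
  have h := ((Real.continuousAt_const_rpow hc).tendsto).comp tendsto_inv_atBot_zero
  rwa [Real.rpow_zero] at h

/-- **5.4.P7, second part**: if every `x_i ≠ 0` then `lim_{p → −∞} ‖x‖_p = min_i |x_i|` (squeeze between
`n^{1/p} m` and `m`). [cite: HornJohnson2013, 5.4.P7 (p0423)] -/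
theorem tendsto_lpNorm_atBot (x : ι → E) (hx : ∀ i, ‖x i‖ ≠ 0) :
    Tendsto (fun p : ℝ => (∑ i, ‖x i‖ ^ p) ^ p⁻¹) atBot
      (𝓝 (Finset.univ.inf' Finset.univ_nonempty fun i => ‖x i‖)) := by
  have hc : (Fintype.card ι : ℝ) ≠ 0 := Nat.cast_ne_zero.mpr Fintype.card_ne_zero
  have hlow : Tendsto (fun p : ℝ => (Fintype.card ι : ℝ) ^ p⁻¹ * (Finset.univ.inf' Finset.univ_nonempty fun i => ‖x i‖))
      atBot (𝓝 (Finset.univ.inf' Finset.univ_nonempty fun i => ‖x i‖)) := by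
    have h := (tendsto_card_rpow_inv_atBot hc).mul_const (Finset.univ.inf' Finset.univ_nonempty fun i => ‖x i‖)
    rwa [one_mul] at h
  refine tendsto_of_tendsto_of_tendsto_of_le_of_le' hlow tendsto_const_nhds ?_ ?_
  · filter_upwards [eventually_lt_atBot 0] with p hp using card_rpow_mul_inf_le_lpNorm x hx hp
  · filter_upwards [eventually_lt_atBot 0] with p hp using lpNorm_le_inf x hx hp

/-- 5.4.P7, second part, for scalar vectors with nonzero entries (`|x| > 0` in the book's notation), exponent `1/p`.
[cite: HornJohnson2013, 5.4.P7 (p0423)] -/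
theorem tendsto_lpNorm_atBot_pi {𝕜 : Type*} [NormedField 𝕜] (x : ι → 𝕜) (hx : ∀ i, x i ≠ 0) :
    Tendsto (fun p : ℝ => (∑ i, ‖x i‖ ^ p) ^ (1 / p)) atBot
      (𝓝 (Finset.univ.inf' Finset.univ_nonempty fun i => ‖x i‖)) := by
  simp only [one_div]
  exact tendsto_lpNorm_atBot x fun i => norm_ne_zero_iff.mpr (hx i)

end Neg

end Literature.Analysis.Matrix.LpNormLimit
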